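import Summits.SmoothPoincare4.SmoothPoincare4.Theses.ZeroSurgeryExotic
import Summits.SmoothPoincare4.SmoothPoincare4.Theorems.ZseSVanishesOnPairs.Negative.MirrorClosure
import Literature.Uncategorized.Crux
import Literature.Topology.FourManifolds.ProjectiveTowers
import Literature.Topology.FourManifolds.OpenTrace
import Literature.Topology.FourManifolds.KirbyMoves
import Literature.Topology.FourManifolds.KnotsProofs
import Summits.SmoothPoincare4.SmoothPoincare4.Statement

/-!
# Line `window-escape` — skeleton r1 for crux `ZeroSurgeryExotic.ZseSVanishesOnPairs` (stmt-SmoothPoincare4-0368)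

Crux (ledger signature verbatim = the tree's registered open statement `Literature.Uncategorized.SVanishesOnPairs`):
for knots `K, K'` with a common `0`-surgery `Y` and `K` smoothly slice, every Rasmussen invariant `s` of `K'` is `0`.

Strategist planner-cstrat-stmt-SmoothPoincare4-0368-p1-0 (wall-breaker gen 1, 2026-08-17), planning the triage-passed,
never-planned idea `Ideas/window-escape.md` (ideator 2) into a checked skeleton.  The LEVER is 3-dimensional: every
`0`-surgery pair `(K, K')` is presented (Manolescu–Piccirillo Thm 3.3 in dual-curve form) by a framed 2-component link
`(K, 0) ∪ (m, k) ⊂ S³` whose surgery is `S³`, with `K'` the core of the `m`-filling (an "honest representative",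
`HonestRep`); representatives of the same pair differ by slides of `m` over `K` (changing `k` by even numbers) and by
re-presentation.  The card's two Kirby identities — (♠) `X_k(m) ⊇ B'` (the pair ball) and (♣)
`X_{-δ}(K') ⊂ X_{k+δ}(m) # (±ℂℙ²)` — turn ONE representative whose framed trace `X_k(m)` resp. `X_{k+δ}(m)` embeds in a
one-chirality `ℂℙ²`-tower (an "escape", `UpperEscapes`) into a certificate for `K'` (`UpperCert o δ K'`: `K'` tower-slice over `o` — the tree's way of saying `X₀(K') ↪ #(ℂℙ², o)`,
i.e. `K̄'` H-slice there — or the `(−δ)`-framed trace of `K'` embeds in an `o`-tower), and MMSW Cor. 1.9 + Ren 2024 Cor. 1.5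
turn the certificate into `0 ≤ s(K')`.  Applying the same ONE-CHIRALITY argument to the mirror representative (`HonestRep` is
mirror-closed, stub 5) gives `s(K') ≤ 0`, hence the crux.  The BET (stub 2, "out of window") is a statement about framed
curves in `S³` — it is NOT implied by `SmoothPoincare4` and its failure produces no exotic sphere (it is then silent), which is
the property the 8th lead's line-dead sweep asked of any new line (`Lines/evidence-entries-dead.md`, last paragraph).

## Convention-robustness (why the odd-looking `δ`)
The tree cannot tell which orientation `o` of `ComplexProjectivePlane` is the complex one (MMSW's fact is stated with `∃ o`,
`ProjectiveTowers.lean`), and the sign convention of `Knot.TubularNbhd.HasFraming` enters (♣).  Both are absorbed by a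
GEOMETRIC PIN: a pair `(o, δ)`, `δ = ±1`, is admissible (`Pin o δ`) when the `(−δ)`-framed open trace of the UNKNOT embeds
orientation-preservingly in an `o`-tower (printed: `X_{−1}(U) = ℂℙ²bar°`, `X_{+1}(U) = ℂℙ²°`; with the literature's framing sign the
admissible pairs are `(o_bar, +1)` and `(o_ℂ, −1)`).  Stubs 2, 3 are stated for ALL admissible `(o, δ)` (at `(o_bar, +1)` they are
the card's UPPER window statements — certificates for `0 ≤ s` —, at `(o_ℂ, −1)` the LOWER ones), stub 4 (the engine) asserts
`∃` an admissible `(o, δ)` at which certificates give `0 ≤ s` (true at `(o_bar, +1)`: MMSW Cor. 1.9 read through the H-slice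
trace embedding lemma, + Ren Cor. 1.5).  A global flip of the tree's framing sign swaps the two admissible `δ`'s and leaves
every stub TRUE.  THREE SIGN-SENSITIVE POINTS (line card §Conventions, re-derive before proving stub 3): (i) the oriented
Manolescu–Piccirillo sphere is `X' = V ∪_φ (−X₀(K'))` (MP 2023 proof of Lemma 3.5: `X(−K') ∪_φ V`), so (♠) `int B' ↪ X_k(m)`
certifies `X₀(K̄') ↪` host, i.e. `K'` tower-slice over the OPPOSITE chirality of the host of `X_k(m)`; (ii) the belt circle of
`h(c)` reads as `K'` itself on `∂B'` with `B'`'s boundary orientation, and its belt framing is both the Seifert framing of `K'`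
and the diagram `0`-framing of the meridian `μ_m`, so (♣) reads `X_λ(K') ⊂ X_{k−λ}(m) # P_λ`, `P_{+1} = ℂℙ²`, `P_{−1} = ℂℙ²bar`;
(iii) hence at an admissible `(o, δ)` the H-hatch uses `X_k(m) ↪ (−o)`-tower and the framed hatch `X_{k+δ}(m) ↪ o`-tower, and
both certify the same sign of `s(K')` (`0 ≤ s` at `(o_bar, +1)`), as Nakamura's Thm 3.13 bullet 1 does on special RBG links.

## Registered stubs (the only `sorry`s)
1. `stub_honestRep_of_pair` — NORMAL FORM (MP 2023 Thm 3.3, dual-curve form; 3-manifold topology, TRUE): a tree pair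
   `(K, K', Y)` has an honest representative presenting `K'` or its mirror image (the tree's pair relation is orientation
   blind, `Negative.MirrorClosure.zeroSurgeryPair_self_mirror`, so one of the two chiralities is the honest one).
2. `stub_escape` — THE BET (card: (OW) "out of window"; OPEN; 3-dimensional; not `SmoothPoincare4`-bracketed): for admissible
   `(o, δ)`, every honest representative of a partner of a SLICE knot can be re-chosen so that it escapes.
3. `stub_framedTransfer` — GENERAL FRAMED TRANSFER (card (♠)+(♣), Kirby calculus + framed trace embedding lemma; TRUE on
   paper, new in this generality; XL in the tree): an escaping honest representative certifies `K'`.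
4. `stub_engine` — MMSW 2023 Cor. 1.9 (H-slice hatch) + Ren 2024 Cor. 1.5 (framed hatch), knot/disc case, at a pinned
   chirality (published; XL: Lee-homology cobordism maps absent from the tree; contains Rasmussen's slice theorem at height 0,
   as every engine of this crux must — the item itself implies it, p72393).
5. `stub_honestRep_mirror` — honest representatives are closed under mirror image (reflect `S³`; TRUE, M).
`ZseSVanishesOnPairs_of : ZseSVanishesOnPairs` concludes the crux BY ITS ROUTE NAME (local materialisation §0, exactly as in
`Lines/embed_dont_dissolve.lean`) and `sVanishesOnPairs_of` under its tree name; the composition is kernel-checked.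
-/

noncomputable section

set_option linter.dupNamespace false

open scoped Manifold ContDiff Topology
open Set Function
open Literature.Topology.FourManifolds

/-! ## §0 Local materialisation of the route decl (delete when the gate writes it) -/

namespace Summit.SmoothPoincare4.SmoothPoincare4.Theses.ZeroSurgeryExotic

/-- **LOCAL MATERIALISATION — item stmt-SmoothPoincare4-0368 · crux · rank 4** (ledger signature verbatim; the
gate-written route file `Theses/ZeroSurgeryExotic.lean` carries this decl only as a TODO comment until
`import Literature.Topology.FourManifolds.LeeRasmussen` is added there — delete this block then).  On a `0`-surgery pair
with `K` smoothly slice, every Rasmussen invariant of `K'` vanishes. [cite: ManolescuMarengonSarkarWillis2023, Question 9.11] -/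
def ZseSVanishesOnPairs : Prop :=
  ∀ (K K' : Literature.Topology.FourManifolds.Knot) (Y : Type) [TopologicalSpace Y] [ChartedSpace (EuclideanSpace ℝ (Fin 3)) Y] (s : ℤ), Literature.Topology.FourManifolds.IsIntegralSurgery (𝓡 3) Y K 0 → Literature.Topology.FourManifolds.IsIntegralSurgery (𝓡 3) Y K' 0 → K.IsSmoothlySlice → K'.HasRasmussenInvariant s → s = 0

/-- The local materialisation IS the tree's registered open statement of item 0368, definitionally. [folklore] -/
theorem zseSVanishesOnPairs_iff_sVanishesOnPairs :
    ZseSVanishesOnPairs ↔ Literature.Uncategorized.SVanishesOnPairs := Iff.rfl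

end Summit.SmoothPoincare4.SmoothPoincare4.Theses.ZeroSurgeryExotic

namespace Summit.SmoothPoincare4.SmoothPoincare4.Cruxes.ZseSVanishesOnPairs.WindowEscape

open Summit.SmoothPoincare4.SmoothPoincare4.Theses.ZeroSurgeryExotic
open Summit.SmoothPoincare4.SmoothPoincare4.Theorems.ZseSVanishesOnPairs.Negative

/-- Local notation: the model space `ℝⁿ`. -/
local notation "𝔼 " n:arg => EuclideanSpace ℝ (Fin n)
/-- Local notation: the unit `n`-sphere. -/
local notation "𝕊 " n:arg => (Metric.sphere (0 : EuclideanSpace ℝ (Fin (n + 1))) 1)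

/-! ## §1 Vocabulary of the line (definitions, no facts) -/

/-- **Framed trace embedding into a one-chirality tower.**  `FramedTraceEmbeds o J f`: for some oriented tubular
neighbourhood `ν` of the knot `J` with framing `f` (`Knot.TubularNbhd.HasFraming`, linking-number convention of
`DehnSurgery.lean`), the OPEN TRACE `X_f(J)°` of the framed knot (`TubeNbhd.OpenTrace`, `OpenTrace.lean`: `ℝ⁴` with an open
2-handle attached along `ν`) embeds smoothly and openly into some `o`-tower `(P, oP)` (`IsProjectiveTower o t P oP`:
`t`-fold oriented connected sum of copies of `(ℂℙ², o)`), ORIENTATION-PRESERVINGLY on the `0`-handle chart `inl : ℝ⁴ → X_f(J)°`.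
This is the tree form of "`X_f(J)` smoothly embeds in `#ᵗ(ℂℙ², o)`", i.e. (framed trace embedding lemma, Nakamura 2023 L2.7)
of "`(J̄, -f)` is slice in `#ᵗ(ℂℙ², o)`" / "`(J, f)` is slice in `#ᵗ(ℂℙ², -o)`".  A definition.
[cite: Nakamura2023, Def. 2.6, Lemma 2.7 and Def. 2.9] -/
def FramedTraceEmbeds (o : SmoothOrientation (𝓡 4) ComplexProjectivePlane) (J : Knot) (f : ℤ) : Prop :=
  ∃ ν : Knot.TubularNbhd J, ν.HasFraming f ∧
    ∃ (t : ℕ) (P : Type) (_ : TopologicalSpace P) (_ : T2Space P) (_ : SecondCountableTopology P)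
      (_ : ChartedSpace (𝔼 4) P) (_ : IsManifold (𝓡 4) ∞ P) (_ : CompactSpace P)
      (oP : SmoothOrientation (𝓡 4) P) (j : ν.toTubeNbhd.OpenTrace → P),
      IsProjectiveTower o t P oP ∧ Manifold.IsSmoothEmbedding (𝓡 4) (𝓡 4) ∞ j ∧ IsOpen (range j) ∧
        IsOrientationPreserving (SmoothOrientation.euclidean 4) oP (j ∘ ν.toTubeNbhd.traceGlueData.inl)

/-- **Admissible chirality pin.**  `Pin o δ`: `δ = ±1` and the `(−δ)`-framed open trace of the UNKNOT embeds
(orientation-preservingly on its `0`-handle) into some `o`-tower.  Printed content: `X_{−1}(U) ≅ ℂℙ²bar°` and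
`X_{+1}(U) ≅ ℂℙ²°`, and a `(∓1)`-framed unknot trace never embeds in a tower of the other definiteness; so — with the
literature's framing sign (`HasFraming` = linking number of the push-off, `DehnSurgery.lean`) — the admissible pairs are exactly
`(o_bar, +1)` and `(o_ℂ, −1)`, `o_ℂ` the complex orientation of the tree's `ComplexProjectivePlane`, `o_bar = −o_ℂ`.  The pin
makes every statement below independent of WHICH orientation of `ComplexProjectivePlane` is the complex one AND of the global
sign convention of `HasFraming` (a global framing flip swaps the two admissible `δ`'s and every stub keeps its truth value —
line card §Conventions).  A definition. [cite: GompfStipsicz1999, §4.4 (the ±1-framed unknot: ℂℙ² and ℂℙ²bar)] -/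
def Pin (o : SmoothOrientation (𝓡 4) ComplexProjectivePlane) (δ : ℤ) : Prop :=
  (δ = 1 ∨ δ = -1) ∧ FramedTraceEmbeds o unknot (-δ)

/-- **Certificate for a knot at an admissible chirality `(o, δ)`.**  `UpperCert o δ J`: EITHER `J` is tower-slice over `o`
(`Knot.IsTowerSlice`: slice data with an orientation-preserving ball chart in some `o`-tower, null-homologous — i.e. the tree's
rendering of "`X₀(J)` embeds in `#ᵗ(ℂℙ², o)`", equivalently (H-slice trace embedding lemma, Nakamura L2.2: `L` H-slice in `W`
iff `−X₀(L) = X₀(L̄) ↪ W`) "`J̄` is H-slice in `#ᵗ(ℂℙ², o)`" — the H-SLICE HATCH, MMSW Cor. 1.9) OR the `(−δ)`-framed open trace of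
`J` embeds in an `o`-tower (the FRAMED HATCH: at `(o_bar, +1)` this reads "`X_{−1}(J) ↪ #ⁿℂℙ²bar`", i.e. "`(J, −1)` is slice in
`#ⁿℂℙ²`", Ren 2024 Cor. 1.5 = Nakamura 2023 Conj. 2.15).  At `(o_bar, +1)` BOTH disjuncts give `0 ≤ s(J)` (H-hatch: `J̄` H-slice
in `#ℂℙ²bar` ⇒ `s(J̄) ≤ 0`; framed hatch: Ren), at `(o_ℂ, −1)` both give `s(J) ≤ 0` — the two hatches are sign-coherent at every
admissible pin (line card §Conventions; this is the point that needed care).  A definition.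
[cite: Nakamura2023, Lemma 2.2, Lemma 2.3, Lemma 2.10 and Conj. 2.15] -/
def UpperCert (o : SmoothOrientation (𝓡 4) ComplexProjectivePlane) (δ : ℤ) (J : Knot) : Prop :=
  J.IsTowerSlice o ∨ FramedTraceEmbeds o J (-δ)

/-- **Escape of a framed representative `(m, k)` at an admissible chirality `(o, δ)`** (the card's "out of the window"):
EITHER `X_k(m)` embeds in a `(−o)`-tower (H-hatch via (♠): at `(o_bar, +1)` this is "`X_k(m) ↪ #ⁿℂℙ²`, i.e. `(m, k)` slice in
`#ⁿℂℙ²bar`, i.e. `k ≥ PF₊(m)`", Nakamura Def. 2.9 / Cor. 2.11 / Lemma 3.5) OR `X_{k+δ}(m)` embeds in an `o`-tower (framed hatch via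
(♣): at `(o_bar, +1)` "`(m, k+1)` slice in `#ⁿℂℙ²`, i.e. `k + 1 ≤ PF₋(m)`", Nakamura Lemma 3.11 generalised).  At `(o_bar, +1)` the
formula is the card's UPPER escape `k ≥ PF₊(m) ∨ k ≤ PF₋(m) − 1`, at `(o_ℂ, −1)` its LOWER escape `k ≤ PF₋(m) ∨ k ≥ PF₊(m) + 1`.
A definition. [cite: Nakamura2023, Def. 2.9, Cor. 2.11, Lemma 3.5 and Lemma 3.11] -/
def UpperEscapes (o : SmoothOrientation (𝓡 4) ComplexProjectivePlane) (δ : ℤ) (m : Knot) (k : ℤ) : Prop :=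
  FramedTraceEmbeds (-o) m k ∨ FramedTraceEmbeds o m (k + δ)

/-- **Honest representative of a pair** (Manolescu–Piccirillo's RBG theorem in dual-curve / 2-component form, card §Normal
form; cf. crux NOTES Part III.2).  `HonestRep K J m k`: there is a framed 2-component link `(K, 0) ∪ (m, k)` in `S³`
(`FramedLink (Fin 2)`, component `0` literally `K` with framing `0`, component `1` the knot `m` with framing `k`) and integral
surgery data ON THE SAME `S³` — oriented tubular neighbourhoods `ν i` with the prescribed framings, an open smooth embedding
`jA` of the link complement and open smooth embeddings `jB i` of the two open solid tori, jointly covering `S³`, glued along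
`Link.surgeryRel ν i` (verbatim the clauses of `IsIntegralSurgeryLink`, `DehnSurgery.lean`) — such that
(HONESTY) `jA` is the identity on some non-empty open set of the complement (so the identification `S³_{0,k}(K ∪ m) ≅ S³` is
orientation preserving; any identification can be so normalised after possibly composing with a reflection, which is what
separates `J` from its mirror image), and (CORE) the core circle `v ↦ jB 1 (0, v)` of the `m`-filling, as a knot, is isotopic
to `J` or to its reverse.  Printed meaning: `m ⊂ S³ ∖ K` is an `S³`-representative of the dual (filling) curve of the
`0`-surgery homeomorphism, `k` its framing, and `J = K'` the partner knot.  A definition.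
[cite: ManolescuPiccirillo2023, Thm. 3.3 and Remark 3.4] [cite: Nakamura2023, Lemma 3.5] -/
def HonestRep (K J m : Knot) (k : ℤ) : Prop :=
  ∃ (L : FramedLink (Fin 2)), L.component 0 = K ∧ L.component 1 = m ∧ L.framing 0 = 0 ∧ L.framing 1 = k ∧
    ∃ ν : ∀ i, Knot.TubularNbhd (L.component i), (∀ i, (ν i).HasFraming (L.framing i)) ∧
      (Pairwise fun i j ↦ Disjoint (range (ν i)) (range (ν j))) ∧
      ∃ (jA : L.complement → 𝕊 3) (jB : Fin 2 → solidTorus → 𝕊 3),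
        Manifold.IsSmoothEmbedding (𝓡 3) (𝓡 3) ∞ jA ∧ IsOpen (range jA) ∧
        (∀ i, Manifold.IsSmoothEmbedding (𝓘(ℝ, 𝔼 2).prod (𝓡 1)) (𝓡 3) ∞ (jB i) ∧ IsOpen (range (jB i))) ∧
        range jA ∪ (⋃ i, range (jB i)) = univ ∧
        (Pairwise fun i j ↦ Disjoint (range (jB i)) (range (jB j))) ∧
        (∀ i a b, jA a = jB i b ↔ Link.surgeryRel ν i a b) ∧
        (∃ U : Set L.complement, IsOpen U ∧ U.Nonempty ∧ ∀ a ∈ U, jA a = (a : 𝕊 3)) ∧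
        ∃ J' : Knot, (∀ v : 𝕊 1, (J' v : 𝕊 3) = jB 1 ⟨((0 : 𝔼 2), v), by simp⟩) ∧
          (J.IsIsotopic J' ∨ J.reverse.IsIsotopic J')

/-! ## §2 The five registered stubs -/

/-- **STUB 1 — NORMAL FORM (Manolescu–Piccirillo Thm. 3.3 in dual-curve form; TRUE, 3-manifold topology, size L).**
If `Y` is `0`-surgery on `K` and on `K'` then `K'` OR ITS MIRROR IMAGE has an honest representative relative to `K`: compose
the two surgery structures to a diffeomorphism `ψ : S³₀(K) → S³₀(K')`, isotope `ψ⁻¹` of the dual knot of `K'` off the surgery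
solid torus of `K` and read it as a framed knot `(m, k) ⊂ S³ ∖ K`; `0`-surgery on `K` followed by surgery on `ψ⁻¹(μ_{K'})`
with the transported framing is `S³` (slam dunk on the `K'` side) and the core of that filling is `K'`; normalise the
identification with `S³` to be the identity near a point, composing with a reflection if necessary — which replaces the
core by its mirror image (the tree's pair relation being orientation blind, `zeroSurgeryPair_self_mirror`, both chiralities
genuinely occur). [cite: ManolescuPiccirillo2023, Thm. 3.3 and Remark 3.4] -/
theorem stub_honestRep_of_pair :
    ∀ (K K' : Knot) (Y : Type) [TopologicalSpace Y] [ChartedSpace (𝔼 3) Y],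
      IsIntegralSurgery (𝓡 3) Y K 0 → IsIntegralSurgery (𝓡 3) Y K' 0 →
        (∃ (m : Knot) (k : ℤ), HonestRep K K' m k) ∨ (∃ (m : Knot) (k : ℤ), HonestRep K K'.mirror m k) := by
  sorry

/-- **STUB 2 — THE BET: OUT-OF-WINDOW ESCAPE (card (OW); OPEN; the load-bearing stub).**  For every admissible chirality
`(o, δ)`, every knot `J` honestly presented relative to a smoothly SLICE knot `K` admits an honest representative `(m', k')`
that escapes: `X_{k'}(m')` embeds in a `(−o)`-tower or `X_{k'+δ}(m')` in an `o`-tower.  At `(o_bar, +1)` this is the card's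
upper window statement "some `S³`-representative has `k ≥ PF₊(m)` or `k ≤ PF₋(m) − 1`", at `(o_ℂ, −1)` the lower one;
representatives of one filling curve differ by slides over `K` (`k ↦ k ± 2`, `m ↦ m #_b K∥`), and other presentations of the
pair are allowed too.  SUPPLY IN PRINT: every super-special RBG presentation (Dunfield–Gong 2025 §5.7: `m = U`, window `{0}` or
empty) escapes — found for 36/36 census pairs (Remark 5.12, "no heuristic reason"); every special RBG link with `R`
biprojectively H-slice or `r` outside `[PF₋(R), PF₊(R))` (Nakamura 2023 Thm. 3.13).  WHY IT MIGHT FAIL: a filling curve whose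
whole slide orbit is trapped inside its windows (Nakamura's immune family `L_i[J]`, Problem 3.14, is trapped in its GIVEN
presentation); the crude cost of a slide is `PF₊ + 4` against a gain of `2` (card T3).  NOT implied by `SmoothPoincare4` and
its failure yields no exotic sphere: it is a statement about framed curves in `S³`. [cite: DunfieldGong2025, §5.7, §5.11 and Remark 5.12]
[cite: Nakamura2023, Thm. 3.13, Lemma 3.5 and Problem 3.14] -/
theorem stub_escape :
    ∀ (o : SmoothOrientation (𝓡 4) ComplexProjectivePlane) (δ : ℤ), Pin o δ →
      ∀ (K J m : Knot) (k : ℤ), K.IsSmoothlySlice → HonestRep K J m k →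
        ∃ (m' : Knot) (k' : ℤ), HonestRep K J m' k' ∧ UpperEscapes o δ m' k' := by
  sorry

/-- **STUB 3 — GENERAL FRAMED TRANSFER (card (♠) + (♣); TRUE on paper, Kirby calculus, XL in the tree).**  Let `(m, k)` honestly
present `J` relative to a slice knot `K` (slice disc `D ⊂ B⁴`, exterior `E = B⁴ ∖ νD`, `∂E = S³₀(K)`, meridian curve `c₀` of `D`,
dual curve `c` with `E ∪ h(c₀) = B⁴`, `E ∪ h(c) = B'` the Manolescu–Piccirillo homotopy ball, `X' = B' ∪ (−B⁴_J) = E ∪_φ (−X₀(J))`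
the ORIENTED pair sphere, in which `J` bounds the cocore of `h(c)`).  (♠) `M := E ∪ h(c₀) ∪ h(c)` read from `B⁴` is the STANDARD
trace `X_k(m) ⊇ B'`, and `X' ∖ {pt} ≅ int B'`, so `X₀(J̄) = −X₀(J) ⊆ X'` embeds in any host of `X_k(m)`: an orientation-preserving
`X_k(m) ↪ (−o)`-tower makes `J̄` — equivalently, reflecting ball chart and ambient orientation (`Knot.IsSliceDiscIn.mirror`,
`IsProjectiveTower.neg`), `J` over `o` — tower-slice, null-homologously (the disc lies in the contractible `B'`): first disjunct
of `UpperCert o δ J`.  (♣) add `h(β, λ)`, `β` the belt circle of `h(c)` (`= J` on `∂B'`, belt framing = Seifert framing), `λ = −δ`: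
read from `B'` one gets `X' # N ⊇ X_{−δ}(J)` (sub-handlebody plus the puncture trick), read from `B⁴` one gets
`B⁴ ∪ h(m, k) ∪ h(μ_m, −δ) ≅ X_{k+δ}(m) # P̂`, `P̂ ⊇ X_{−δ}(U)` the closed-up `(−δ)`-framed unknot trace (blow down the meridian,
`lk = 1`), and `X_{−δ}(U)` sits in an `o`-tower by `Pin o δ` (so `P̂` is `(ℂℙ², o)` up to the tower bookkeeping); hence
`X_{k+δ}(m) ↪ o`-tower gives `X_{−δ}(J) ↪ o`-tower: second disjunct.  So an escaping representative yields `UpperCert o δ J`, at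
every admissible `(o, δ)` (both identities are chirality-symmetric once `δ` is pinned to `o`).  Inputs absent from the tree: handle
attachment / sliding / blow-down as diffeomorphisms of glued manifolds, the identification `B' ≅ E ∪ h(c)` (cf.
`ZeroSurgeryHomotopyBallSliceGluing.lean`, `0`-framed case), uniqueness of oriented connected sums.  SANITY CHECKS (paper): for a
super-special pair `(m, k) = (U, r)`, `r ≥ 1`, the H-hatch at `(o_bar, +1)` is Nakamura's Cor. 3.2 (`s(K') ≥ 0`) and the framed hatch
of the mirror representative `(U, −r)` is his Lemma 3.11 (`s(K̄') ≥ 0`); `(μ_K, 0)` (the diagonal `K' = K`) escapes at height `0`.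
[cite: Nakamura2023, Lemma 2.2, Lemma 2.7, Cor. 3.2, Lemma 3.5 and Lemma 3.11] [cite: ManolescuPiccirillo2023, Thm. 3.3 and proof of Lemma 3.5] -/
theorem stub_framedTransfer :
    ∀ (o : SmoothOrientation (𝓡 4) ComplexProjectivePlane) (δ : ℤ), Pin o δ →
      ∀ (K J m : Knot) (k : ℤ), K.IsSmoothlySlice → HonestRep K J m k → UpperEscapes o δ m k →
        UpperCert o δ J := by
  sorry

/-- **STUB 4 — THE ENGINE at a pinned chirality: MMSW 2023 Cor. 1.9 (H-slice hatch) and Ren 2024 Cor. 1.5 (framed hatch),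
knot/disc case (published theorems; XL in the tree).**  There is an admissible `(o, δ)` — namely `o = o_bar` (the orientation whose
towers are the printed `#ᵗℂℙ²bar`), `δ = +1` with the literature's framing sign (`X_{−1}(U) = ℂℙ²bar°`) — such that every knot
certified at `(o, δ)` has all its Rasmussen invariants `≥ 0`: `J` tower-slice over `o_bar` means `X₀(J) ↪ #ᵗℂℙ²bar`, i.e. `J̄`
H-slice in `#ᵗℂℙ²bar`, so `s(J̄) ≤ 0` (MMSW Cor. 1.9) and `s(J) ≥ 0` (`HasRasmussenInvariant.mirror_holds`); and
`X_{−1}(J) ↪ #ᵗℂℙ²bar` ⇔ `(J, −1)` slice in `#ᵗℂℙ²` ⇒ `s(J) ≥ 0` (Ren's adjunction inequality `s ≤ 1 − χ − [Σ]² − |[Σ]|` in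
`#ᵗℂℙ²bar`, all classes, mirrored; a `(∓1)`-framed disc has a unit class — Nakamura Conj. 2.15, proved as Ren Cor. 1.5).  With the
opposite framing sign the witness is `δ = −1` at the same `o` and the framed disjunct reads the same printed statement; at the
other admissible pin `(o_ℂ, ∓1)` both disjuncts certify `s ≤ 0` instead, so `∃` is the right quantifier.  In terms of the tree's
named fact `Knot.rasmussen_nonpos_of_isTowerSlice` (`∃ o₀, tower-slice over o₀ ⇒ s ≤ 0`): `o = −o₀`, via `J.IsTowerSlice (−o₀) ↔
J̄.IsTowerSlice o₀`.  Inputs absent from the tree: Lee-homology cobordism maps, MMSW's `s` for links in `#ʳ(S¹ × S²)`, `s(F_p(1))`,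
Ren's bar-natan-homology argument.  At height `0` the H-slice hatch is one half of Rasmussen's slice theorem
`eq_zero_of_isSmoothlySlice` — unavoidable: the crux itself implies that theorem (p72393).
[cite: ManolescuMarengonSarkarWillis2023, Cor. 1.9, Def. 6.2 and Remark 6.6] [cite: Ren2024, Thm. 1.1 and Cor. 1.5] [cite: Nakamura2023, Conj. 2.15] -/
theorem stub_engine :
    ∃ (o : SmoothOrientation (𝓡 4) ComplexProjectivePlane) (δ : ℤ), Pin o δ ∧
      ∀ (J : Knot), UpperCert o δ J → ∀ s : ℤ, J.HasRasmussenInvariant s → 0 ≤ s := by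
  sorry

/-- **STUB 5 — MIRROR CLOSURE OF HONEST REPRESENTATIVES (TRUE, size M).**  Reflect `S³` in the hyperplane `x₃ = 0`
(`Knot.mirror`, `FramedLink.mirror`: components mirrored, framings negated; the tree's `FramedLink.IsSurgery.mirror`,
`KirbyMovesMirrorProofs.lean`, builds the mirrored tubular neighbourhoods): conjugating `jA`, `jB` by the reflection keeps the
honesty clause (identity on the reflected open set) and carries the core to the mirror image (possibly reversed) of the core.
So `(m̄, −k)` honestly presents `J̄` relative to `K̄`. [cite: GompfStipsicz1999, §5.1] -/
theorem stub_honestRep_mirror :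
    ∀ (K J m : Knot) (k : ℤ), HonestRep K J m k → ∃ (m' : Knot) (k' : ℤ), HonestRep K.mirror J.mirror m' k' := by
  sorry

/-! ## §3 The composition (kernel-checked): stubs 1–5 ⇒ the crux by name -/

/-- **One-sided consequence at a pinned chirality**: if `(o, δ)` is admissible and certificates at `(o, δ)` give `0 ≤ s`, then
every knot honestly presented relative to a slice knot has all Rasmussen invariants `≥ 0` (stubs 2 and 3). [folklore] -/
theorem nonneg_of_honestRep {o : SmoothOrientation (𝓡 4) ComplexProjectivePlane} {δ : ℤ} (hpin : Pin o δ)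
    (hE : ∀ (J : Knot), UpperCert o δ J → ∀ s : ℤ, J.HasRasmussenInvariant s → 0 ≤ s)
    {K J m : Knot} {k : ℤ} (hK : K.IsSmoothlySlice) (hrep : HonestRep K J m k) {s : ℤ}
    (hs : J.HasRasmussenInvariant s) : 0 ≤ s := by
  obtain ⟨m', k', hrep', hesc⟩ := stub_escape o δ hpin K J m k hK hrep
  exact hE J (stub_framedTransfer o δ hpin K J m' k' hK hrep' hesc) s hs

/-- **Both inequalities from ONE chirality** (stub 5 + the proved mirror facts `isSmoothlySlice_mirror`,
`HasRasmussenInvariant.mirror_holds`): a knot honestly presented relative to a slice knot has `s = 0`. [folklore] -/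
theorem eq_zero_of_honestRep {o : SmoothOrientation (𝓡 4) ComplexProjectivePlane} {δ : ℤ} (hpin : Pin o δ)
    (hE : ∀ (J : Knot), UpperCert o δ J → ∀ s : ℤ, J.HasRasmussenInvariant s → 0 ≤ s)
    {K J m : Knot} {k : ℤ} (hK : K.IsSmoothlySlice) (hrep : HonestRep K J m k) {s : ℤ}
    (hs : J.HasRasmussenInvariant s) : s = 0 := by
  have h1 : 0 ≤ s := nonneg_of_honestRep hpin hE hK hrep hs
  obtain ⟨m', k', hrep'⟩ := stub_honestRep_mirror K J m k hrep
  have h2 : 0 ≤ -s :=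
    nonneg_of_honestRep hpin hE (isSmoothlySlice_mirror hK) hrep' (HasRasmussenInvariant.mirror_holds hs)
  omega

/-- **THE SKELETON THEOREM: the crux BY NAME** from the five registered stubs. [cite: ManolescuMarengonSarkarWillis2023, Question 9.11] -/
theorem ZseSVanishesOnPairs_of : ZseSVanishesOnPairs := by
  intro K K' Y _ _ s hK hK' hsl hs
  obtain ⟨o, δ, hpin, hE⟩ := stub_engine
  rcases stub_honestRep_of_pair K K' Y hK hK' with ⟨m, k, hrep⟩ | ⟨m, k, hrep⟩
  · exact eq_zero_of_honestRep hpin hE hsl hrep hs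
  · have h : -s = 0 := eq_zero_of_honestRep hpin hE hsl hrep (HasRasmussenInvariant.mirror_holds hs)
    omega

/-- The same under the crux's tree name `Literature.Uncategorized.SVanishesOnPairs`. [cite: ManolescuMarengonSarkarWillis2023, Question 9.11] -/
theorem sVanishesOnPairs_of : Literature.Uncategorized.SVanishesOnPairs :=
  ZseSVanishesOnPairs_of

end Summit.SmoothPoincare4.SmoothPoincare4.Cruxes.ZseSVanishesOnPairs.WindowEscape

end
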